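import Summits.Ventures.CertifiedManyBodySolver.Observables.StiffnessApexTransportFanTwoSided
import HarnessLib

/-!
# Ventures/CertifiedManyBodySolver — Observables/StiffnessApexTransportFanDoped.lean

HONEST FRAMING: one-sided certified CEILINGS on the uniform flux stiffness (t–t′ f-sum class) at ANY density, TRANSPORTED from ONE solved
source point to BOTH sides of its apex curve; conditional on the source rows named (f-sum orbit row + a `K₂` BRACKET on the source class) and on
a `K₂` bracket on the TARGET class — for which the KINEMATIC bracket `|K₂| ≤ 1.6211390` is always available; a ceiling never speaks to the
presence of order; not a `T_c` estimate, not a superconductivity verdict; no phase sentence. Zero compute, no definition, no claim node, no `sorry`.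

Cell `pub/hubbard-downfold` (D-0150 L-DF2 «box ↦ one word»), seat `hubbard-downfold-unc-2` (`prover-hubbard-downfold-unc-2-g16-0`); the
ANY-DENSITY edition of `Observables/StiffnessApexTransportFanTwoSided.lean` (there `n = 1` makes two of the four hinges free by `t′K₂ ≤ 0`).

THE FOUR-HINGE FAN. Source `A = (t′_A, U_A, n)`, target `P = (t′_P, U_P, n)`, `0 ≤ U_A < U_P`, `κ = (U_P t′_A − U_A t′_P)/(U_P − U_A)` the apex
hopping; `K₂` brackets `B_A ≤ K₂(ω_A) ≤ A_A`, `B_P ≤ K₂(ω_P) ≤ A_P` with `B ≤ 0 ≤ A` (a positive floor is weakened to `0` — the hinge form pays for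
that simplification). Then
`e_{2t′_A}(ω_A) ≤ e_κ(ω_A) + (κ − 2t′_A)⁺(−B_A) + (2t′_A − κ)⁺A_A`, `e_κ(ω_A) ≤ e_κ(ω_P)` (apex row), `e_κ(ω_P) ≤ e_{2t′_P}(ω_P) + (2t′_P − κ)⁺(−B_P) + (κ − 2t′_P)⁺A_P`,
so the f-sum stiffness ceiling at `P` is at most `−r + [(κ − 2t′_A)⁺(−B_A) + (2t′_A − κ)⁺A_A + (2t′_P − κ)⁺(−B_P) + (κ − 2t′_P)⁺A_P]/4` — EVERY
target above the station line, no geometric side condition. With the kinematic brackets on both classes the price is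
`(|κ − 2t′_A| + |κ − 2t′_P|)·1.6211390/4`: a doped point words a band around its apex curve of half-width `≈ (bar − w)/0.81` in `κ`.
On a rectangle `[t₁, t₂] × [U₁, U₂]` (`t′_A ≤ t₁`, `U_A < U₁`) `κ` is smallest at `(t₂, U₁)` and largest at `(t₁, U₂)`, so all four hinges are bounded
by corner values ⇒ one decidable inequality per rectangle (kinematic target bracket; the source bracket is the point's own words).

* §1 the four-hinge point theorem; kinematic-target and fully kinematic corollaries;  §2 `κ ≤ κ(t₁, U₂)` on a rectangle; the rectangle theorem.

References: T. Koma, H. Tasaki, J. Stat. Phys. 76 (1994) 745, §1 [KomaTasaki1994]; D. J. Scalapino, S. R. White, S.-C. Zhang, PRB 47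
(1993) 7995, §II [ScalapinoWhiteZhang1993]; E. H. Lieb, M. Loss, *Analysis* (AMS 2001, 2nd ed.) §8, Theorem 8.2 [LiebLoss1993].
-/

noncomputable section

namespace Summit.Ventures.CertifiedManyBodySolver.Observables

open Literature.MathematicalPhysics.QuantumLattice
open Literature.MathematicalPhysics.QuantumLattice.ThermodynamicLimit
open Literature.MathematicalPhysics.QuantumFieldTheory
open Literature.Probability.LatticeModels
open Matrix Finset Filter Topology HubbardWave0
open scoped Matrix BigOperators ComplexOrder

/-! ## §1 The four-hinge fan at any density -/

section FourHinge

variable {t'A UA n : ℝ}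

/-- **Hinge comparison of two hoppings under a `K₂` bracket** (`B ≤ K₂(ω) ≤ A`, `B ≤ 0 ≤ A`): for ANY `κ, κ'`,
`e_{Φ(t,κ',0)}(ω) ≤ e_{Φ(t,κ,0)}(ω) + (κ − κ')⁺·(−B) + (κ' − κ)⁺·A`. [cite: KomaTasaki1994, §1] -/
theorem meanEnergy_hopping_le_add_hinges (ω : InfVolFermionState 2) (t : ℝ) {κ κ' B A : ℝ} (hB0 : B ≤ 0) (hA0 : 0 ≤ A)
    (hB : B ≤ ω.meanEnergy (hubbardTTPrimeFermionInteraction 0 1 0) 1)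
    (hA : ω.meanEnergy (hubbardTTPrimeFermionInteraction 0 1 0) 1 ≤ A) :
    ω.meanEnergy (hubbardTTPrimeFermionInteraction t κ' 0) 1 ≤
      ω.meanEnergy (hubbardTTPrimeFermionInteraction t κ 0) 1 + max (κ - κ') 0 * -B + max (κ' - κ) 0 * A := by
  have h1 : 0 ≤ max (κ - κ') 0 * -B := mul_nonneg (le_max_right _ _) (by linarith)
  have h2 : 0 ≤ max (κ' - κ) 0 * A := mul_nonneg (le_max_right _ _) hA0
  rcases le_total κ κ' with hle | hge
  · have h := InfVolFermionState.meanEnergy_hopping_le_add_mul_of_diagHop_le ω t hle hA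
    have hm : (κ' - κ) * A ≤ max (κ' - κ) 0 * A := mul_le_mul_of_nonneg_right (le_max_left _ _) hA0
    linarith
  · have h := InfVolFermionState.meanEnergy_hopping_add_mul_le_of_le_diagHop ω t hge hB
    have hm : (κ - κ') * -B ≤ max (κ - κ') 0 * -B := mul_le_mul_of_nonneg_right (le_max_left _ _) (by linarith)
    nlinarith

/-- **THE FOUR-HINGE FAN (any density `0 ≤ n < 2`).** A certified f-sum orbit row `r` at the source `(t′_A, U_A, n)` (`U_A ≥ 0`, cap certified), a
bracket `B_A ≤ K₂ ≤ A_A` on the source class and a bracket `B_P ≤ K₂ ≤ A_P` on the target class `(t′_P, U_P, n)` (`B ≤ 0 ≤ A` both) give, for EVERY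
target with `U_A < U_P`, `ObsStiffnessSeqCeilingAt t′_P U_P n c` for every
`c ≥ −r + [(κ − 2t′_A)⁺(−B_A) + (2t′_A − κ)⁺A_A + (2t′_P − κ)⁺(−B_P) + (κ − 2t′_P)⁺A_P]/4`, `κ = (U_P t′_A − U_A t′_P)/(U_P − U_A)`.
[cite: KomaTasaki1994, §1] [cite: ScalapinoWhiteZhang1993, §II] -/
theorem ObsStiffnessSeqCeilingAt_on_apexFourHingeFan_of_fsumRow (Uo : ℝ) (hUA : 0 ≤ UA) (hn0 : 0 ≤ n) (hn2 : n < 2) {u r : ℚ}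
    (hrow : SquareTTPrimeCorrOrbitLowerRow t'A UA n u r Finset.univ (box 2 7) (-oddMomentObsTT t'A Uo 0))
    (hu : energyDensityTT' 1 t'A UA n ≤ ((u : ℚ) : ℝ)) {BA AA : ℝ} (hBA0 : BA ≤ 0) (hAA0 : 0 ≤ AA)
    (hBA : ∀ (ω : InfVolFermionState 2) (Ls : ℕ → ℕ) (ψ : ∀ L, Fock (Orb (FermionTorus 2 L))),
      Tendsto Ls atTop atTop →
      (∀ j, IsGroundStateInSector (hubbardTorusTT' (Ls j) 1 t'A UA) (rectN n (Ls j)) 0 (ψ (Ls j))) →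
      (∀ j, star (ψ (Ls j)) ⬝ᵥ ψ (Ls j) = 1) → ω.IsTorusLimitOf ψ Ls →
      BA ≤ ω.meanEnergy (hubbardTTPrimeFermionInteraction 0 1 0) 1)
    (hAA : ∀ (ω : InfVolFermionState 2) (Ls : ℕ → ℕ) (ψ : ∀ L, Fock (Orb (FermionTorus 2 L))),
      Tendsto Ls atTop atTop →
      (∀ j, IsGroundStateInSector (hubbardTorusTT' (Ls j) 1 t'A UA) (rectN n (Ls j)) 0 (ψ (Ls j))) →
      (∀ j, star (ψ (Ls j)) ⬝ᵥ ψ (Ls j) = 1) → ω.IsTorusLimitOf ψ Ls →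
      ω.meanEnergy (hubbardTTPrimeFermionInteraction 0 1 0) 1 ≤ AA)
    {t'P UP : ℝ} {BP AP : ℝ} (hBP0 : BP ≤ 0) (hAP0 : 0 ≤ AP)
    (hBP : ∀ (ω : InfVolFermionState 2) (Ls : ℕ → ℕ) (ψ : ∀ L, Fock (Orb (FermionTorus 2 L))),
      Tendsto Ls atTop atTop →
      (∀ j, IsGroundStateInSector (hubbardTorusTT' (Ls j) 1 t'P UP) (rectN n (Ls j)) 0 (ψ (Ls j))) →
      (∀ j, star (ψ (Ls j)) ⬝ᵥ ψ (Ls j) = 1) → ω.IsTorusLimitOf ψ Ls →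
      BP ≤ ω.meanEnergy (hubbardTTPrimeFermionInteraction 0 1 0) 1)
    (hAP : ∀ (ω : InfVolFermionState 2) (Ls : ℕ → ℕ) (ψ : ∀ L, Fock (Orb (FermionTorus 2 L))),
      Tendsto Ls atTop atTop →
      (∀ j, IsGroundStateInSector (hubbardTorusTT' (Ls j) 1 t'P UP) (rectN n (Ls j)) 0 (ψ (Ls j))) →
      (∀ j, star (ψ (Ls j)) ⬝ᵥ ψ (Ls j) = 1) → ω.IsTorusLimitOf ψ Ls →
      ω.meanEnergy (hubbardTTPrimeFermionInteraction 0 1 0) 1 ≤ AP)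
    (hU : UA < UP) (c : ℚ)
    (hc : -((r : ℚ) : ℝ) + (max ((UP * t'A - UA * t'P) / (UP - UA) - 2 * t'A) 0 * -BA +
      max (2 * t'A - (UP * t'A - UA * t'P) / (UP - UA)) 0 * AA +
      max (2 * t'P - (UP * t'A - UA * t'P) / (UP - UA)) 0 * -BP +
      max ((UP * t'A - UA * t'P) / (UP - UA) - 2 * t'P) 0 * AP) / 4 ≤ ((c : ℚ) : ℝ)) :
    ObsStiffnessSeqCeilingAt t'P UP n c := by
  set κ : ℝ := (UP * t'A - UA * t'P) / (UP - UA) with hκ_def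
  intro ρs θ₀ _ hθ₀ Ls hLs hst
  refine fluxStiffness_le_of_torusLimitTT'_oddMoment_orbit_certificate_seq t'P (U := UP) (δ := 1 - n) (q := ((c : ℚ) : ℝ)) 0
    Finset.univ Finset.univ_nonempty (by linarith) (by linarith) hθ₀ hLs hst ?_
  intro ω Ms ψ hMs hψ h1 hω
  have hψ' : ∀ j, IsGroundStateInSector (hubbardTorusTT' (Ms j) 1 t'P UP) (rectN n (Ms j)) 0 (ψ (Ms j)) := fun j => by
    simpa only [sub_sub_cancel] using hψ j
  rw [orbitMean_rotOddMomentLimitFunctionalTT_lam_zero_eq_meanEnergy_twice_tPrime hω.isTranslationInvariant]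
  obtain ⟨ψA, φ, ωA, hφ, hψA, hψA1, hωA, -, -, -⟩ :=
    exists_isTorusLimitOf_sectorGroundState_TT' 1 t'A UA hn0 hn2.le (Ls := id) tendsto_id
  have hLφ : Tendsto (id ∘ φ : ℕ → ℕ) atTop atTop := tendsto_id.comp hφ.tendsto_atTop
  -- apex row: `e_κ(ω_A) ≤ e_κ(ω_P)`
  have hapx := InfVolFermionState.IsTorusLimitOf.meanEnergy_apexHopping_le_of_groundStates 1 t'A t'P hUA hU hn0 hn2
    hωA hLφ (fun j => hψA _) (fun j => hψA1 _) hω hMs hψ' h1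
  simp only [← hκ_def] at hapx
  -- target end: `e_κ(ω_P) ≤ e_{2t′_P}(ω_P) + (2t′_P − κ)⁺(−B_P) + (κ − 2t′_P)⁺A_P`
  have htgt := meanEnergy_hopping_le_add_hinges ω 1 (κ := 2 * t'P) (κ' := κ) hBP0 hAP0
    (hBP ω Ms ψ hMs hψ' h1 hω) (hAP ω Ms ψ hMs hψ' h1 hω)
  -- source end: `e_{2t′_A}(ω_A) ≤ e_κ(ω_A) + (κ − 2t′_A)⁺(−B_A) + (2t′_A − κ)⁺A_A`
  have hsrc := meanEnergy_hopping_le_add_hinges ωA 1 (κ := κ) (κ' := 2 * t'A) hBA0 hAA0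
    (hBA ωA (id ∘ φ) ψA hLφ (fun j => hψA _) (fun j => hψA1 _) hωA)
    (hAA ωA (id ∘ φ) ψA hLφ (fun j => hψA _) (fun j => hψA1 _) hωA)
  have hv := hrow ωA (id ∘ φ) ψA hLφ (fun j => hψA _) (fun j => hψA1 _) hωA hu
  rw [orbitMean_re_expect_neg_oddMomentTT_lam_zero hωA.isTranslationInvariant] at hv
  linarith

/-- **The kinematic `K₂` FLOOR on every class**: `−1.6211390 ≤ K₂(ω)` (companion of `forall_torusLimit_diagHop_le_kinematic`). [cite: LiebLoss1993, §8, Theorem 8.2] -/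
theorem forall_torusLimit_kinematic_le_diagHop (t' U : ℝ) {n : ℝ} (hn0 : 0 ≤ n) (hn2 : n < 2) :
    ∀ (ω : InfVolFermionState 2) (Ls : ℕ → ℕ) (ψ : ∀ L, Fock (Orb (FermionTorus 2 L))),
      Tendsto Ls atTop atTop →
      (∀ j, IsGroundStateInSector (hubbardTorusTT' (Ls j) 1 t' U) (rectN n (Ls j)) 0 (ψ (Ls j))) →
      (∀ j, star (ψ (Ls j)) ⬝ᵥ ψ (Ls j) = 1) → ω.IsTorusLimitOf ψ Ls →
      -(1.6211390 : ℝ) ≤ ω.meanEnergy (hubbardTTPrimeFermionInteraction 0 1 0) 1 := by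
  intro ω Ls ψ hLs hψ h1 hω
  have hN : ∀ j, IsNParticle (rectN n (Ls j)) (ψ (Ls j)) := fun j => ((mem_szSector_iff _ _ _).1 (hψ j).1).1
  exact (abs_le.1 (hω.abs_meanEnergy_diagHop_le_decimal hn0 hn2 hLs hN h1)).1

/-- **Four-hinge fan, KINEMATIC target bracket** (`−1.6211390 ≤ K₂(ω_P) ≤ 1.6211390`, no word at the target): every target with `U_A < U_P` and
`c ≥ −r + [(κ − 2t′_A)⁺(−B_A) + (2t′_A − κ)⁺A_A + |κ − 2t′_P|·1.6211390]/4` (the two target hinges add up to `|κ − 2t′_P|·1.6211390`).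
[cite: KomaTasaki1994, §1] [cite: LiebLoss1993, §8, Theorem 8.2] -/
theorem ObsStiffnessSeqCeilingAt_on_apexFourHingeFan_of_fsumRow_kinematicTarget (Uo : ℝ) (hUA : 0 ≤ UA) (hn0 : 0 ≤ n) (hn2 : n < 2)
    {u r : ℚ} (hrow : SquareTTPrimeCorrOrbitLowerRow t'A UA n u r Finset.univ (box 2 7) (-oddMomentObsTT t'A Uo 0))
    (hu : energyDensityTT' 1 t'A UA n ≤ ((u : ℚ) : ℝ)) {BA AA : ℝ} (hBA0 : BA ≤ 0) (hAA0 : 0 ≤ AA)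
    (hBA : ∀ (ω : InfVolFermionState 2) (Ls : ℕ → ℕ) (ψ : ∀ L, Fock (Orb (FermionTorus 2 L))),
      Tendsto Ls atTop atTop →
      (∀ j, IsGroundStateInSector (hubbardTorusTT' (Ls j) 1 t'A UA) (rectN n (Ls j)) 0 (ψ (Ls j))) →
      (∀ j, star (ψ (Ls j)) ⬝ᵥ ψ (Ls j) = 1) → ω.IsTorusLimitOf ψ Ls →
      BA ≤ ω.meanEnergy (hubbardTTPrimeFermionInteraction 0 1 0) 1)
    (hAA : ∀ (ω : InfVolFermionState 2) (Ls : ℕ → ℕ) (ψ : ∀ L, Fock (Orb (FermionTorus 2 L))),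
      Tendsto Ls atTop atTop →
      (∀ j, IsGroundStateInSector (hubbardTorusTT' (Ls j) 1 t'A UA) (rectN n (Ls j)) 0 (ψ (Ls j))) →
      (∀ j, star (ψ (Ls j)) ⬝ᵥ ψ (Ls j) = 1) → ω.IsTorusLimitOf ψ Ls →
      ω.meanEnergy (hubbardTTPrimeFermionInteraction 0 1 0) 1 ≤ AA)
    {t'P UP : ℝ} (hU : UA < UP) (c : ℚ)
    (hc : -((r : ℚ) : ℝ) + (max ((UP * t'A - UA * t'P) / (UP - UA) - 2 * t'A) 0 * -BA +
      max (2 * t'A - (UP * t'A - UA * t'P) / (UP - UA)) 0 * AA +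
      |(UP * t'A - UA * t'P) / (UP - UA) - 2 * t'P| * 1.6211390) / 4 ≤ ((c : ℚ) : ℝ)) :
    ObsStiffnessSeqCeilingAt t'P UP n c := by
  refine ObsStiffnessSeqCeilingAt_on_apexFourHingeFan_of_fsumRow Uo hUA hn0 hn2 hrow hu hBA0 hAA0 hBA hAA (by norm_num) (by norm_num)
    (forall_torusLimit_kinematic_le_diagHop t'P UP hn0 hn2) (forall_torusLimit_diagHop_le_kinematic t'P UP hn0 hn2) hU c ?_
  set κ : ℝ := (UP * t'A - UA * t'P) / (UP - UA)
  have habs : max (2 * t'P - κ) 0 * -(-(1.6211390 : ℝ)) + max (κ - 2 * t'P) 0 * 1.6211390 = |κ - 2 * t'P| * 1.6211390 := by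
    rcases le_total κ (2 * t'P) with h | h
    · rw [max_eq_left (by linarith), max_eq_right (by linarith), abs_of_nonpos (by linarith)]; ring
    · rw [max_eq_right (by linarith), max_eq_left (by linarith), abs_of_nonneg (by linarith)]; ring
  linarith [habs]

/-- **Four-hinge fan, fully KINEMATIC** (no `K₂` word anywhere): `c ≥ −r + (|κ − 2t′_A| + |κ − 2t′_P|)·1.6211390/4`. At `n = 1` the companion files
are far cheaper (two hinges free); this edition is the hypothesis-free doped fallback. [cite: KomaTasaki1994, §1] [cite: LiebLoss1993, §8, Theorem 8.2] -/
theorem ObsStiffnessSeqCeilingAt_on_apexFourHingeFan_of_fsumRow_kinematic (Uo : ℝ) (hUA : 0 ≤ UA) (hn0 : 0 ≤ n) (hn2 : n < 2)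
    {u r : ℚ} (hrow : SquareTTPrimeCorrOrbitLowerRow t'A UA n u r Finset.univ (box 2 7) (-oddMomentObsTT t'A Uo 0))
    (hu : energyDensityTT' 1 t'A UA n ≤ ((u : ℚ) : ℝ)) {t'P UP : ℝ} (hU : UA < UP) (c : ℚ)
    (hc : -((r : ℚ) : ℝ) + (|(UP * t'A - UA * t'P) / (UP - UA) - 2 * t'A| +
      |(UP * t'A - UA * t'P) / (UP - UA) - 2 * t'P|) * 1.6211390 / 4 ≤ ((c : ℚ) : ℝ)) :
    ObsStiffnessSeqCeilingAt t'P UP n c := by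
  refine ObsStiffnessSeqCeilingAt_on_apexFourHingeFan_of_fsumRow_kinematicTarget Uo hUA hn0 hn2 hrow hu (by norm_num) (by norm_num)
    (forall_torusLimit_kinematic_le_diagHop t'A UA hn0 hn2) (forall_torusLimit_diagHop_le_kinematic t'A UA hn0 hn2) hU c ?_
  set κ : ℝ := (UP * t'A - UA * t'P) / (UP - UA)
  have habs : max (κ - 2 * t'A) 0 * -(-(1.6211390 : ℝ)) + max (2 * t'A - κ) 0 * 1.6211390 = |κ - 2 * t'A| * 1.6211390 := by
    rcases le_total κ (2 * t'A) with h | h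
    · rw [max_eq_right (by linarith), max_eq_left (by linarith), abs_of_nonpos (by linarith)]; ring
    · rw [max_eq_left (by linarith), max_eq_right (by linarith), abs_of_nonneg (by linarith)]; ring
  linarith [habs]

end FourHinge

/-! ## §2 Rectangles at any density -/

section Rect

variable {t'A UA n : ℝ}

/-- **`κ` is largest at the corner `(t₁, U₂)` of a rectangle** (`U_A ≥ 0`, `U_A < U ≤ U₂`, `t₁ ≤ t`, `t′_A ≤ t₁`): `κ(t, U) ≤ κ(t₁, U₂)`. [folklore] -/
theorem apexFan_kappa_le_corner {t U t₁ U₂ : ℝ} (hUA : 0 ≤ UA) (hUAU : UA < U) (hU : U ≤ U₂) (ht : t₁ ≤ t) (ht'A : t'A ≤ t₁) :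
    (U * t'A - UA * t) / (U - UA) ≤ (U₂ * t'A - UA * t₁) / (U₂ - UA) := by
  have h1 : 0 < U - UA := sub_pos.2 hUAU
  have h2 : 0 < U₂ - UA := by linarith
  have hκt : (U * t'A - UA * t) / (U - UA) ≤ (U * t'A - UA * t₁) / (U - UA) :=
    div_le_div_of_nonneg_right (by nlinarith [mul_nonneg hUA (sub_nonneg.2 ht)]) h1.le
  have hκU : (U * t'A - UA * t₁) / (U - UA) ≤ (U₂ * t'A - UA * t₁) / (U₂ - UA) := by
    rw [div_le_div_iff₀ h1 h2]
    nlinarith [mul_nonneg hUA (mul_nonneg (sub_nonneg.2 hU) (sub_nonneg.2 ht'A))]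
  exact hκt.trans hκU

/-- **ONE DOPED POINT WORDS A RECTANGLE by one decidable inequality** (any density; source word `−r ≤ w`; source bracket `B_A ≤ K₂ ≤ A_A` with
`B_A ≤ 0 ≤ A_A` and decimal relaxations `b ≤ B_A`, `A_A ≤ a`; kinematic target bracket): for `[t₁, t₂] × [U₁, U₂]` with `t′_A ≤ t₁`, `U_A < U₁` and
`c ≥ w + [(κ(t₁,U₂) − 2t′_A)⁺(−b) + (2t′_A − κ(t₂,U₁))⁺a + (2t₂ − κ(t₂,U₁))⁺·1.6211390 + (κ(t₁,U₂) − 2t₁)⁺·1.6211390]/4`,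
`ObsStiffnessSeqCeilingAt tp U n c` at every point of the rectangle. [cite: KomaTasaki1994, §1] [cite: ScalapinoWhiteZhang1993, §II] -/
theorem ObsStiffnessSeqCeilingAt_on_rect_of_fsumRow_fourHinge_kinematicTarget (Uo : ℝ) (hUA : 0 ≤ UA) (hn0 : 0 ≤ n) (hn2 : n < 2)
    {u r : ℚ} (hrow : SquareTTPrimeCorrOrbitLowerRow t'A UA n u r Finset.univ (box 2 7) (-oddMomentObsTT t'A Uo 0))
    (hu : energyDensityTT' 1 t'A UA n ≤ ((u : ℚ) : ℝ)) {BA AA : ℝ} (hBA0 : BA ≤ 0) (hAA0 : 0 ≤ AA)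
    (hBA : ∀ (ω : InfVolFermionState 2) (Ls : ℕ → ℕ) (ψ : ∀ L, Fock (Orb (FermionTorus 2 L))),
      Tendsto Ls atTop atTop →
      (∀ j, IsGroundStateInSector (hubbardTorusTT' (Ls j) 1 t'A UA) (rectN n (Ls j)) 0 (ψ (Ls j))) →
      (∀ j, star (ψ (Ls j)) ⬝ᵥ ψ (Ls j) = 1) → ω.IsTorusLimitOf ψ Ls →
      BA ≤ ω.meanEnergy (hubbardTTPrimeFermionInteraction 0 1 0) 1)
    (hAA : ∀ (ω : InfVolFermionState 2) (Ls : ℕ → ℕ) (ψ : ∀ L, Fock (Orb (FermionTorus 2 L))),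
      Tendsto Ls atTop atTop →
      (∀ j, IsGroundStateInSector (hubbardTorusTT' (Ls j) 1 t'A UA) (rectN n (Ls j)) 0 (ψ (Ls j))) →
      (∀ j, star (ψ (Ls j)) ⬝ᵥ ψ (Ls j) = 1) → ω.IsTorusLimitOf ψ Ls →
      ω.meanEnergy (hubbardTTPrimeFermionInteraction 0 1 0) 1 ≤ AA)
    {w b a : ℝ} (hw : -((r : ℚ) : ℝ) ≤ w) (hb : b ≤ BA) (ha : AA ≤ a)
    {t₁ t₂ U₁ U₂ : ℝ} (ht₁ : t'A ≤ t₁) (hU₁ : UA < U₁) (c : ℚ)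
    (hc : w + (max ((U₂ * t'A - UA * t₁) / (U₂ - UA) - 2 * t'A) 0 * -b +
      max (2 * t'A - (U₁ * t'A - UA * t₂) / (U₁ - UA)) 0 * a +
      max (2 * t₂ - (U₁ * t'A - UA * t₂) / (U₁ - UA)) 0 * 1.6211390 +
      max ((U₂ * t'A - UA * t₁) / (U₂ - UA) - 2 * t₁) 0 * 1.6211390) / 4 ≤ ((c : ℚ) : ℝ)) :
    ∀ tp ∈ Set.Icc t₁ t₂, ∀ U ∈ Set.Icc U₁ U₂, ObsStiffnessSeqCeilingAt tp U n c := by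
  intro tp htp U hU
  have hb0 : b ≤ 0 := hb.trans hBA0
  have ha0 : 0 ≤ a := hAA0.trans ha
  refine ObsStiffnessSeqCeilingAt_on_apexFourHingeFan_of_fsumRow Uo hUA hn0 hn2 hrow hu hBA0 hAA0 hBA hAA (by norm_num) (by norm_num)
    (forall_torusLimit_kinematic_le_diagHop tp U hn0 hn2) (forall_torusLimit_diagHop_le_kinematic tp U hn0 hn2)
    (by linarith [hU.1]) c ?_
  -- corner monotonicity of `κ`
  have hlo := apexFan_kappa_corner_le (t'A := t'A) hUA hU₁ hU.1 htp.2 (ht₁.trans (htp.1.trans htp.2))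
  have hhi := apexFan_kappa_le_corner (t'A := t'A) hUA (by linarith [hU.1]) hU.2 htp.1 ht₁
  set κ : ℝ := (U * t'A - UA * tp) / (U - UA) with hκ
  set κlo : ℝ := (U₁ * t'A - UA * t₂) / (U₁ - UA)
  set κhi : ℝ := (U₂ * t'A - UA * t₁) / (U₂ - UA)
  -- the four hinges against their corner values
  have e₁ : max (κ - 2 * t'A) 0 * -BA ≤ max (κhi - 2 * t'A) 0 * -b :=
    (mul_le_mul_of_nonneg_right (max_le_max (by linarith) le_rfl) (by linarith)).trans
      (mul_le_mul_of_nonneg_left (by linarith) (le_max_right _ _))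
  have e₂ : max (2 * t'A - κ) 0 * AA ≤ max (2 * t'A - κlo) 0 * a :=
    (mul_le_mul_of_nonneg_right (max_le_max (by linarith) le_rfl) hAA0).trans
      (mul_le_mul_of_nonneg_left ha (le_max_right _ _))
  have e₃ : max (2 * tp - κ) 0 * -(-(1.6211390 : ℝ)) ≤ max (2 * t₂ - κlo) 0 * 1.6211390 := by
    rw [neg_neg]
    exact mul_le_mul_of_nonneg_right (max_le_max (by linarith [htp.2]) le_rfl) (by norm_num)
  have e₄ : max (κ - 2 * tp) 0 * (1.6211390 : ℝ) ≤ max (κhi - 2 * t₁) 0 * 1.6211390 :=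
    mul_le_mul_of_nonneg_right (max_le_max (by linarith [htp.1]) le_rfl) (by norm_num)
  linarith

end Rect

end Summit.Ventures.CertifiedManyBodySolver.Observables

end
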